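import Summits.HodgeConjecture.HodgeConjecture.Theorems.Ring2AbelianAllSpreadFrame
import Summits.HodgeConjecture.HodgeConjecture.Theorems.PadicSemiregularLiftHodgeAbelianVarietiesAndreReduction
import HarnessLib

/-!
# Ring 2 · AbelianAll · SPREAD axis, part X — the domination rows of part II RE-BASED on the tree's PROVED
# André reduction: `S_ZD` makes `HC_CM` idle modulo ONE eigen-typed anchoring input and NO Literature fact

HONEST FRAMING: research route, not a corollary; conditional on HC_CM plus one named minimal statement.
(Cell-wide: research route conditional on HC_CM; not a corollary; Q11.4-sentence-2 already refuted in dim ≥ 3.)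

Cell `pub-hodge-ring2`, sub-cell AbelianAll, seat `pub-hodge-ring2-ab-spread-1` (gen 13). `HC_CM` is ALWAYS the binder
`Theses.RankFourFaces.CMAbelianHodge` (stmt-HodgeConjecture-3052); `HC_AV` = `Theses.PadicSemiregularLift.HodgeAbelianVarieties`
(stmt-1333). Nothing here is a case of the Hodge conjecture; every `@[conjecture] def` below is a HYPOTHESIS of OUR theory,
never cited as a fact. `B_min` of record (F_CM, part VII) is untouched.

## Why this part exists (the OWNER'S DECISION asked for by the literature seat, RING2-MAP `## §lit (gen 21)` L103)

Part II (`Ring2AbelianAllSpreadDomination`) proved that the brief's spreading sentence S_ZD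
(`SpreadFromZariskiDenseCMPoints`) DOMINATES `HC_CM`: (D_ZD) `S_ZD ∧ DA_q ∧ DA_K ⟹ HC_CM`, (E₃_ZD) `(HC_CM ∧ S_ZD) ↔ S_ZD`
— but MODULO the Literature binder `h𝔄 : Andre1992_hodgeClasses_cmAbelianVariety_mem_span_pullback_weilClasses`
(André 1992, refereed, UNDISCHARGED in the tree), because the anchoring inputs DA_q / DA_K are typed by the
imaginary-quadratic resp. CM FIELD of the Weil structure and feed hweil's FIELD-typed rungs R∞ / R3. The literature
seat found (L100–L103) that André's reduction is KERNEL-PROVED summit-side by the crux line `cm-pivot-andre`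
(`CMPivotAndre.cmAbelianHodge_of_cmWeilClassesAlgebraic`, 2026-08-17, axioms standard) with an EIGEN-typed antecedent
— "rational `(p,p)` Weil eigen-classes on abelian varieties with a CM subalgebra are algebraic" — INCOMPARABLE as typed
with `R∞ ∧ R3` (L103 (ii)), and left the re-base to the owners. The deformation axis declined for its rows (D.163:
their inputs are field-typed families; a swap would need the size-L packaging (★)). THE SPREADING AXIS CAN RE-BASE
HONESTLY, because it OWNS the anchoring carriers: re-type the anchoring input by the crux's eigen-data (DA_eig below);
then `S_ZD ∧ DA_eig ⟹` (the eigen core) is the same one-line spreading step as part II's, and the PROVED reduction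
finishes with NO named fact. Decision: RE-BASE = this file (additive; part II stays as the field-typed reading).

## Ledger of the re-base (Literature binders per row; `hF` = Deligne 1982 Prop. 6.1, refereed, the family fact)

| row | part II (field-typed inputs DA_q, DA_K) | part X (eigen-typed input DA_eig) |
|---|---|---|
| D  `S_ZD ∧ inputs ⟹ HC_CM` | [h𝔄] | **none** (`HC_CM_of_denselyAnchoredEigen_of_spreadZD`) |
| M  `S_ZD ∧ inputs ⟹ HC_AV` | [hF, h𝔄] | [hF] |
| E₂ `HC_AV ↔ S_ZD` | [hF, h𝔄] | [hF] |
| E₃ `(HC_CM ∧ S_ZD) ↔ S_ZD` | [h𝔄] | **none** |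
| frame `CMIdle S_ZD` | [hF, h𝔄] | [hF] |
| inputs on-path `HC_CM ⟹ inputs` | [hF] (stated from `HC_AV` in part II; sharpened here) | [hF] |
| residual exactness `inputs ↔ HC_CM` granted S_ZD | [hF, h𝔄] (stated here, §4) | [hF] (`denselyAnchoredEigen_iff_HC_CM_of_spreadZD`) |

COUNT ONCE: the arrow `W_eig ⟹ HC_CM` is the crux line's theorem (`cm-pivot-andre`, stubs 1 + 3 proved, 22 modules),
re-exported here BY NAME under a cone name; credit theirs. New here: the cone NAME `CMWeilEigenClassesAlgebraic` (W_eig)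
for the crux's open core with the kernel EXACTNESS `HC_CM ↔ W_eig` (André's reduction as a fact-free `iff`), the
eigen-typed anchoring node DA_eig, and the seven rows above. HONEST COLUMN. (a) DA_eig is OPEN and, like DA_q / DA_K, a
typed design input: PRINT supplies anchored families only for eigenvalue fields that are imaginary quadratic (Deligne,
LNM 900, proof of Thm. 4.8: the points `A₀ ⊗ E`) or CM of degree `> 2` (André 1996 Lemme 6.3.3: one elliptic-power
fibre; density of CM anchors is OUR inference), and nothing for the non-CM eigenvalue fields the core admits (lit's
example `(E_i⁴, ℚ(√(1+2i)))`, L101) — there DA_eig leans on `HC_CM` + `hF` alone. (b) Granted S_ZD and `hF`, DA_eig is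
EXACTLY `HC_CM` (§4): the domination rows say "S_ZD absorbs `HC_CM` into an anchoring statement of the kind print
methods produce", not that the anchoring is in print. (c) DA_eig vs DA_q ∧ DA_K: incomparable as typed (CM carrier,
any eigenvalue field vs any carrier, CM field); modulo S_ZD ∧ hF the eigen input implies the field inputs fact-free
and the converse costs [h𝔄] (§4). (d) "Minimal" is claimed nowhere.

References: [Andre1992HodgeCM] Théorème; [Markman2025SurveySecant] Thm. 1.4 (André's reduction as used by Markman);
[Deligne1982HodgeCycles] Thm. 4.8 (proof, pp. 50–51), Prop. 6.1; [Andre1996Motifs] §6.3 Lemme 6.3.3, Remarque 2;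
[CharlesSchnell2014Notes] Conj. 11.3.1, Thm. 11.5.11, Cor. 11.3.6; [MoonenZarhin1998WeilClasses] §1;
[vanGeemen1994HodgeAV] 4.8–4.9, Thm. 4.3. PerL / QW8 / the 2001 programme are cited nowhere.
-/

-- every declaration of this problem lives in `Summit.HodgeConjecture.HodgeConjecture.…` (summit = sub-problem).
set_option linter.dupNamespace false

noncomputable section

namespace Summit.HodgeConjecture.HodgeConjecture.Ring2.AbelianAll

open CategoryTheory AlgebraicGeometry
open Literature.AlgebraicGeometry Literature.AlgebraicGeometry.Motives
open Literature.AlgebraicGeometry.HodgeTheory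
open Literature.AlgebraicGeometry.Deligne1982 (deligne1982_cmDenseMumfordTateFamilies)
open Literature.AlgebraicTopology.SingularHomology
open Summit.HodgeConjecture.HodgeConjecture
open Summit.HodgeConjecture.HodgeConjecture.WeilTypeLadder
open Summit.HodgeConjecture.HodgeConjecture.Theses
open Summit.HodgeConjecture.HodgeConjecture.Theses.RankFourFaces (CMAbelianHodge CMToAbelian)
open Summit.HodgeConjecture.HodgeConjecture.Theses.PadicSemiregularLift (HodgeAbelianVarieties)
open Summit.HodgeConjecture.HodgeConjecture.Ring2.Deform
open Summit.HodgeConjecture.HodgeConjecture.Ring2.Hypotheses (AbelianSchemeVHC)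

/-! ## §1 W_eig — the crux line's open core under a cone name, and André's reduction as a fact-free `iff` -/

/-- **W_eig — `CMWeilEigenClassesAlgebraic` (OPEN; typed HYPOTHESIS of our theory; the open core of crux line
`cm-pivot-andre`, stub 2 `CMWeilClassesAlgebraic`, VERBATIM, given a cone name).** For every complex abelian variety `A`
with a CM subalgebra (`∃ S ⊆ End⁰(A)` reduced, commutative, `dim_ℚ S = 2 dim A` — the item's `IsCMSub`, = `IsOfCMType A`),
every endomorphism `ψ`, every `p > 0` and every finite set `S ⊂ ℂ ∖ ℝ` of eigenvalues of `ψ^*` on `H¹` with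
`⨁_{μ ∈ S} V_μ = H¹` and `dim V_μ = 2p`: every RATIONAL `(p,p)` class in the span of the eigen-classes
`⨁_{μ ∈ S} {c | (x + yψ)^* c = (x + yμ)^{2p} c}` ("Weil eigen-classes") is ALGEBRAIC. A SLICE of `HC_CM`
(`cmWeilEigenClassesAlgebraic_of_HC_CM`) which GENERATES `HC_CM` by the tree's PROVED André reduction
(`HC_CM_of_cmWeilEigenClassesAlgebraic`): `HC_CM ↔ W_eig` in the kernel, no Literature binder. NOT asserted.
[cite: Andre1992HodgeCM, Théorème] [cite: Markman2025SurveySecant, Thm. 1.4] [cite: vanGeemen1994HodgeAV, 4.8–4.9]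
[cite: MoonenZarhin1998WeilClasses, §1] [status: open] -/
@[conjecture] def CMWeilEigenClassesAlgebraic : Prop :=
  ∀ (A : AbelianVariety ℂ), (∃ S : Subalgebra ℚ (AbelianVariety.endAlgebra A), IsReduced ↥S ∧
      (∀ x ∈ S, ∀ y ∈ S, x * y = y * x) ∧ Module.finrank ℚ ↥S = 2 * AbelianVariety.dim A) →
    ∀ (ψ : A ⟶ A) (p : ℕ) (S : Finset ℂ), 0 < p → (∀ μ ∈ S, μ.im ≠ 0) →
    (⨆ μ ∈ S, Module.End.eigenspace (complexBetti.map ψ.hom.hom.hom 1).hom μ) = ⊤ →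
    (∀ μ ∈ S, Module.finrank ℂ (Module.End.eigenspace (complexBetti.map ψ.hom.hom.hom 1).hom μ) = 2 * p) →
    ∀ c : complexBetti A.X (2 * p), IsRationalClass c → IsOfHodgeType A.dim A.X (2 * p) p p c →
      c ∈ (⨆ μ ∈ S, pullbackEigenclasses A ψ (2 * p) (fun x y => ((x : ℂ) + (y : ℂ) * μ) ^ (2 * p))) →
      c ∈ algebraicClasses A.X p

/-- **André's reduction, BY NAME** (count once: crux line `cm-pivot-andre`, `CMPivotAndre.cmAbelianHodge_of_cmWeilClassesAlgebraic`,
stubs 1 + 3 proved 2026-08-17): `W_eig ⟹ HC_CM`, NO Literature binder. [cite: Andre1992HodgeCM, Théorème]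
[cite: Markman2025SurveySecant, Thm. 1.4] -/
theorem HC_CM_of_cmWeilEigenClassesAlgebraic (hW : CMWeilEigenClassesAlgebraic) : CMAbelianHodge :=
  Theorems.HodgeAbelianVarieties.CMPivotAndre.cmAbelianHodge_of_cmWeilClassesAlgebraic hW

/-- W_eig is a SLICE of `HC_CM` (its carriers are CM abelian varieties; `HC_CM` at `A` is `HodgeConjectureFor A.dim A.X`,
whose second component is algebraicity of every rational `(p,p)` class). [folklore] -/
theorem cmWeilEigenClassesAlgebraic_of_HC_CM (hCM : CMAbelianHodge) : CMWeilEigenClassesAlgebraic :=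
  fun A hS _ p _ _ _ _ _ c hc hpp _ ↦ (hCM A (AbelianVariety.isSmoothProjective_holds (A := A)) hS).2 p c hc hpp

/-- **EXACTNESS `HC_CM ↔ W_eig`** — André 1992's reduction as a KERNEL `iff` with no Literature binder: the Hodge
conjecture for CM abelian varieties IS the algebraicity of the rational Weil eigen-classes on them.
[cite: Andre1992HodgeCM, Théorème] [cite: Markman2025SurveySecant, Thm. 1.4] -/
theorem HC_CM_iff_cmWeilEigenClassesAlgebraic : CMAbelianHodge ↔ CMWeilEigenClassesAlgebraic :=
  ⟨cmWeilEigenClassesAlgebraic_of_HC_CM, HC_CM_of_cmWeilEigenClassesAlgebraic⟩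

/-- ON-PATH: `HC_AV ⟹ W_eig`. [folklore] -/
theorem cmWeilEigenClassesAlgebraic_of_HC_AV (h : HodgeAbelianVarieties) : CMWeilEigenClassesAlgebraic :=
  cmWeilEigenClassesAlgebraic_of_HC_CM (HC_CM_of_HC_AV h)

/-- ON-PATH: `HodgeConjecture ⟹ W_eig`. [folklore] -/
theorem cmWeilEigenClassesAlgebraic_of_hodgeConjecture (h : _root_.HodgeConjecture) : CMWeilEigenClassesAlgebraic :=
  cmWeilEigenClassesAlgebraic_of_HC_AV (HC_AV_of_hodgeConjecture h)

/-- The item relativises the same way: `W_eig ∧ CMToAbelian ⟹ HC_AV` (the crux line's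
`hodgeAbelianVarieties_of_cmWeilClassesAlgebraic_of_cmToAbelian`, by name through `HC_CM`). [cite: Andre1992HodgeCM, Théorème] -/
theorem HC_AV_of_cmWeilEigenClassesAlgebraic_of_cmToAbelian (hW : CMWeilEigenClassesAlgebraic) (hT : CMToAbelian) :
    HodgeAbelianVarieties :=
  fun A ↦ hT (HC_CM_of_cmWeilEigenClassesAlgebraic hW) A (AbelianVariety.isSmoothProjective_holds (A := A))

/-! ## §2 DA_eig — the anchoring input RE-TYPED by the crux's eigen-data -/

/-- **DA_eig — `DenselyAnchoredEigenWeilClassesCM` (OPEN; typed HYPOTHESIS; print + an inference, never cited as a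
fact).** Every class in W_eig's scope (a rational `(p,p)` Weil eigen-class on a complex abelian variety with a CM
subalgebra, for eigen-data `(ψ, S)` as in W_eig) is DENSELY ANCHORED (`denselyAnchoredClasses`, part II: a smooth
projective abelian family through `A` over a smooth irreducible quasi-projective base, a global fibrewise rational
`(p,p)` class through the class, and a set of CM fibres, Zariski-dense on points, where it is algebraic). The eigen-typed
sibling of part II's DA_q / DA_K. PRINT: for an imaginary-quadratic eigenvalue field, Deligne's Weil family through the
carrier contains the points `A₀ ⊗ E` ("`A₀` any abelian variety of dimension `d/2`"), where the Weil classes are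
algebraic (LNM 900, proof of Thm. 4.8, pp. 50–51); for a CM eigenvalue field of degree `> 2`, André's Hodge-type family
has a fibre isogenous to a power of an elliptic curve, where `B = D` (Lemme 6.3.3; [KuM91]); the CM choice of the
anchors and their Zariski density (Hecke translates, real approximation) is OUR inference; for NON-CM eigenvalue fields
(allowed by the core: lit L101's `(E_i⁴, ℚ(√(1+2i)))`) print has no family and the node leans on `HC_CM` + `hF` alone
(`denselyAnchoredEigen_of_deligne1982_of_HC_CM`). Implied by `HC_CM` granted the refereed family fact; EXACTLY `HC_CM`
granted S_ZD and that fact (§4). NOT asserted. [cite: Deligne1982HodgeCycles, Thm. 4.8 (proof, pp. 50–51) and Prop. 6.1]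
[cite: Andre1996Motifs, §6.3 Lemme 6.3.3] [cite: vanGeemen1994HodgeAV, Thm. 4.3] [cite: PlatonovRapinchuk1994, Thm. 7.7]
[status: open] -/
@[conjecture] def DenselyAnchoredEigenWeilClassesCM : Prop :=
  ∀ (A : AbelianVariety ℂ), (∃ S : Subalgebra ℚ (AbelianVariety.endAlgebra A), IsReduced ↥S ∧
      (∀ x ∈ S, ∀ y ∈ S, x * y = y * x) ∧ Module.finrank ℚ ↥S = 2 * AbelianVariety.dim A) →
    ∀ (ψ : A ⟶ A) (p : ℕ) (S : Finset ℂ), 0 < p → (∀ μ ∈ S, μ.im ≠ 0) →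
    (⨆ μ ∈ S, Module.End.eigenspace (complexBetti.map ψ.hom.hom.hom 1).hom μ) = ⊤ →
    (∀ μ ∈ S, Module.finrank ℂ (Module.End.eigenspace (complexBetti.map ψ.hom.hom.hom 1).hom μ) = 2 * p) →
    ∀ c : complexBetti A.X (2 * p), IsRationalClass c → IsOfHodgeType A.dim A.X (2 * p) p p c →
      c ∈ (⨆ μ ∈ S, pullbackEigenclasses A ψ (2 * p) (fun x y => ((x : ℂ) + (y : ℂ) * μ) ^ (2 * p))) →
      c ∈ denselyAnchoredClasses A p

/-- **S_ZD + DA_eig ⟹ W_eig** — the spreading step, with NO `HC_CM` and NO named fact: S_ZD spreads algebraicity from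
the anchors to the fibre through `A` (part II `mem_algebraicClasses_of_mem_denselyAnchored_of_spreadZD`).
[cite: CharlesSchnell2014Notes, Conj. 11.3.1] -/
theorem cmWeilEigenClassesAlgebraic_of_denselyAnchoredEigen_of_spreadZD (hD : DenselyAnchoredEigenWeilClassesCM)
    (hS : SpreadFromZariskiDenseCMPoints) : CMWeilEigenClassesAlgebraic :=
  fun A hA ψ p S hp hS' htop hrk c hc hpp hw ↦
    mem_algebraicClasses_of_mem_denselyAnchored_of_spreadZD hS (hD A hA ψ p S hp hS' htop hrk c hc hpp hw)

/-! ## §3 The domination rows of part II, re-based: no André binder -/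

/-- **(D_eig) `HC_CM_of_denselyAnchoredEigen_of_spreadZD` — the brief's spreading sentence PROVES Hodge-for-CM granted
ONE eigen-typed anchoring input, with NO Literature fact** (part II's (D_ZD) needed `h𝔄` = André 1992 and the two
field-typed inputs): S_ZD gives W_eig (§2) and the tree's proved André reduction gives `HC_CM` (§1).
[cite: Andre1992HodgeCM, Théorème] [cite: CharlesSchnell2014Notes, Conj. 11.3.1] -/
theorem HC_CM_of_denselyAnchoredEigen_of_spreadZD (hD : DenselyAnchoredEigenWeilClassesCM)
    (hS : SpreadFromZariskiDenseCMPoints) : CMAbelianHodge :=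
  HC_CM_of_cmWeilEigenClassesAlgebraic (cmWeilEigenClassesAlgebraic_of_denselyAnchoredEigen_of_spreadZD hD hS)

/-- **(M_eig) `HC_AV` from S_ZD and DA_eig — NO Hodge-for-CM hypothesis**, granted only the refereed family fact `hF`
(part II's (M_ZD) needed `hF` and `h𝔄`): (D_eig), then part I's `HC_AV_of_HC_CM_and_spreadZD`.
[cite: Deligne1982HodgeCycles, Prop. 6.1] [cite: CharlesSchnell2014Notes, Thm. 11.5.11] -/
theorem HC_AV_of_denselyAnchoredEigen_of_spreadZD (hF : deligne1982_cmDenseMumfordTateFamilies)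
    (hD : DenselyAnchoredEigenWeilClassesCM) (hS : SpreadFromZariskiDenseCMPoints) : HodgeAbelianVarieties :=
  HC_AV_of_HC_CM_and_spreadZD hF (HC_CM_of_denselyAnchoredEigen_of_spreadZD hD hS) hS

/-- **(E₂_eig) `HC_AV ↔ S_ZD`** granted `hF` and DA_eig (part II's (E₂_ZD): `hF`, `h𝔄`, DA_q, DA_K).
[cite: CharlesSchnell2014Notes, Cor. 11.3.6] [cite: Deligne1982HodgeCycles, Prop. 6.1] -/
theorem HC_AV_iff_spreadZD_of_denselyAnchoredEigen (hF : deligne1982_cmDenseMumfordTateFamilies)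
    (hD : DenselyAnchoredEigenWeilClassesCM) : HodgeAbelianVarieties ↔ SpreadFromZariskiDenseCMPoints :=
  ⟨spreadFromZariskiDenseCMPoints_of_HC_AV, HC_AV_of_denselyAnchoredEigen_of_spreadZD hF hD⟩

/-- **(E₃_eig) What `HC_CM` is worth next to S_ZD: nothing — `(HC_CM ∧ S_ZD) ↔ S_ZD` granted DA_eig ALONE; no
Literature binder at all** (part II's (E₃_ZD) needed `h𝔄`). [cite: Andre1992HodgeCM, Théorème] -/
theorem HC_CM_and_spreadZD_iff_of_denselyAnchoredEigen (hD : DenselyAnchoredEigenWeilClassesCM) :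
    (CMAbelianHodge ∧ SpreadFromZariskiDenseCMPoints) ↔ SpreadFromZariskiDenseCMPoints :=
  ⟨fun h ↦ h.2, fun hS ↦ ⟨HC_CM_of_denselyAnchoredEigen_of_spreadZD hD hS, hS⟩⟩

/-- **Frame row, re-based: `CMIdle S_ZD`** (LEAD grammar `Ring2AbelianAllFrame.CMIdle`) granted `hF` and DA_eig — part
III's `cmIdle_spreadZD` needed `hF`, `h𝔄`, DA_q, DA_K. This is the arrow the deformation axis's standing rule D.163 (γ)
waits for. [cite: Deligne1982HodgeCycles, Prop. 6.1] -/
theorem cmIdle_spreadZD_of_denselyAnchoredEigen (hF : deligne1982_cmDenseMumfordTateFamilies)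
    (hD : DenselyAnchoredEigenWeilClassesCM) : CMIdle SpreadFromZariskiDenseCMPoints :=
  fun hS ↦ HC_AV_of_denselyAnchoredEigen_of_spreadZD hF hD hS

/-- Hence `CMIdle` for every node ABOVE S_ZD, e.g. typer2's (1) `AbelianSchemeVHC`, granted `hF` and DA_eig only.
[folklore] -/
theorem cmIdle_abelianSchemeVHC_of_denselyAnchoredEigen (hF : deligne1982_cmDenseMumfordTateFamilies)
    (hD : DenselyAnchoredEigenWeilClassesCM) : CMIdle AbelianSchemeVHC :=
  cmIdle_antitone spreadFromZariskiDenseCMPoints_of_abelianSchemeVHC (cmIdle_spreadZD_of_denselyAnchoredEigen hF hD)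

/-- The KIND split of the Mumford–Tate branch in one line, re-based: granted `hF` and DA_eig, `S_ZD ↔ HC_AV` outright,
while for U the tree has only `HC_AV ↔ HC_CM ∧ U`. [folklore] -/
theorem spreadZD_iff_HC_AV_and_uniform_exact_of_denselyAnchoredEigen (hF : deligne1982_cmDenseMumfordTateFamilies)
    (hD : DenselyAnchoredEigenWeilClassesCM) :
    (SpreadFromZariskiDenseCMPoints ↔ HodgeAbelianVarieties) ∧
      (HodgeAbelianVarieties ↔ (CMAbelianHodge ∧ UniformAlgebraicityAtCMPoints)) :=
  ⟨(HC_AV_iff_spreadZD_of_denselyAnchoredEigen hF hD).symm, (exactWithCM_spreadAxis hF).2.2⟩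

/-! ## §4 On-path and exactness of the anchoring inputs: they are consequences of `HC_CM` (not only of `HC_AV`),
and granted S_ZD they are EXACTLY `HC_CM` -/

/-- **Densely anchored from `HC_CM` alone** (sharpening part II's `mem_denselyAnchoredClasses_of_deligne1982_of_HC_AV`,
whose proof already used only `HC_CM`): under `HC_CM` the CM-dense Mumford–Tate family of the refereed fact through
`(A, c)` densely anchors `c` — `HC_CM` makes the global class algebraic at every CM fibre, and the CM locus is dense,
hence Zariski-dense on points. [cite: Deligne1982HodgeCycles, Prop. 6.1] [cite: CharlesSchnell2014Notes, Thm. 11.5.11] -/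
theorem mem_denselyAnchoredClasses_of_deligne1982_of_HC_CM (hF : deligne1982_cmDenseMumfordTateFamilies)
    (hCM : CMAbelianHodge) (A : AbelianVariety ℂ) (hA : IsSmoothProjective A.dim A.X) (p : ℕ)
    (c : complexBetti A.X (2 * p)) (hc : IsRationalClass c) (hpp : IsOfHodgeType A.dim A.X (2 * p) p p c) :
    c ∈ denselyAnchoredClasses A p := by
  obtain ⟨𝒳, S, f, s₁, e, W, hf, h𝒳, hS, hirr, hsm, hab, hW, hWc, hD⟩ :=
    cmDenseMumfordTateFamilies_of_deligne1982 hF A hA p c hc hpp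
  refine ⟨𝒳, S, f, s₁, e, W, cmLocus f A.dim, hf, h𝒳, hS, hirr, hsm, hab, hW, hWc, subset_rfl,
    zariskiClosureOnPoints_eq_univ_of_dense hD, fun s hs => ?_⟩
  exact forall_cmLocus_mem_algebraicClasses_of_HC_CM hCM f W hW s hs

/-- ON-PATH: `HC_CM ⟹ DA_eig` granted the refereed family fact. [cite: Deligne1982HodgeCycles, Prop. 6.1] -/
theorem denselyAnchoredEigen_of_deligne1982_of_HC_CM (hF : deligne1982_cmDenseMumfordTateFamilies)
    (hCM : CMAbelianHodge) : DenselyAnchoredEigenWeilClassesCM :=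
  fun A _ _ p _ _ _ _ _ c hc hpp _ ↦
    mem_denselyAnchoredClasses_of_deligne1982_of_HC_CM hF hCM A (AbelianVariety.isSmoothProjective_holds (A := A)) p c hc hpp

/-- ON-PATH: `HC_AV ⟹ DA_eig` granted the refereed family fact. [cite: Deligne1982HodgeCycles, Prop. 6.1] -/
theorem denselyAnchoredEigen_of_deligne1982_of_HC_AV (hF : deligne1982_cmDenseMumfordTateFamilies)
    (h : HodgeAbelianVarieties) : DenselyAnchoredEigenWeilClassesCM :=
  denselyAnchoredEigen_of_deligne1982_of_HC_CM hF (HC_CM_of_HC_AV h)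

/-- ON-PATH, sharpened: `HC_CM ⟹ DA_q` granted the family fact (part II stated it from `HC_AV`).
[cite: Deligne1982HodgeCycles, Prop. 6.1] -/
theorem denselyAnchoredWeilFamiliesImaginaryQuadratic_of_deligne1982_of_HC_CM
    (hF : deligne1982_cmDenseMumfordTateFamilies) (hCM : CMAbelianHodge) :
    DenselyAnchoredWeilFamiliesImaginaryQuadratic := by
  intro n _ d _ A φ hdim hA _ c hc hpp _
  have hA' : IsSmoothProjective A.dim A.X := by rw [hdim]; exact hA
  have hpp' : IsOfHodgeType A.dim A.X (2 * n) n n c := by rw [hdim]; exact hpp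
  exact mem_denselyAnchoredClasses_of_deligne1982_of_HC_CM hF hCM A hA' n c hc hpp'

/-- ON-PATH, sharpened: `HC_CM ⟹ DA_K` granted the family fact (part II stated it from `HC_AV`).
[cite: Deligne1982HodgeCycles, Prop. 6.1] -/
theorem denselyAnchoredWeilFamiliesCMField_of_deligne1982_of_HC_CM
    (hF : deligne1982_cmDenseMumfordTateFamilies) (hCM : CMAbelianHodge) : DenselyAnchoredWeilFamiliesCMField := by
  intro A φ P e m _ _ _ _ _ _ _ _ c _ hrat hpp
  exact mem_denselyAnchoredClasses_of_deligne1982_of_HC_CM hF hCM A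
    (AbelianVariety.isSmoothProjective_holds (A := A)) m c hrat hpp

/-- **RESIDUAL EXACTNESS: granted S_ZD and the family fact, DA_eig ↔ HC_CM** — the eigen-typed anchoring input is
neither more nor less than Hodge-for-CM once the spreading sentence is granted (⟸ is on-path; ⟹ is (D_eig)).
[cite: Deligne1982HodgeCycles, Prop. 6.1] [cite: Andre1992HodgeCM, Théorème] -/
theorem denselyAnchoredEigen_iff_HC_CM_of_spreadZD (hF : deligne1982_cmDenseMumfordTateFamilies)
    (hS : SpreadFromZariskiDenseCMPoints) : DenselyAnchoredEigenWeilClassesCM ↔ CMAbelianHodge :=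
  ⟨fun hD ↦ HC_CM_of_denselyAnchoredEigen_of_spreadZD hD hS, denselyAnchoredEigen_of_deligne1982_of_HC_CM hF⟩

/-- The same for part II's field-typed inputs, at the price of André 1992: granted S_ZD, `hF` and `h𝔄`,
`(DA_q ∧ DA_K) ↔ HC_CM`. [cite: Andre1992HodgeCM, Théorème] [cite: Deligne1982HodgeCycles, Prop. 6.1] -/
theorem denselyAnchoredWeil_iff_HC_CM_of_spreadZD (hF : deligne1982_cmDenseMumfordTateFamilies)
    (h𝔄 : Andre1992_hodgeClasses_cmAbelianVariety_mem_span_pullback_weilClasses)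
    (hS : SpreadFromZariskiDenseCMPoints) :
    (DenselyAnchoredWeilFamiliesImaginaryQuadratic ∧ DenselyAnchoredWeilFamiliesCMField) ↔ CMAbelianHodge :=
  ⟨fun h ↦ HC_CM_of_denselyAnchored_of_spreadZD h𝔄 h.1 h.2 hS,
    fun hCM ↦ ⟨denselyAnchoredWeilFamiliesImaginaryQuadratic_of_deligne1982_of_HC_CM hF hCM,
      denselyAnchoredWeilFamiliesCMField_of_deligne1982_of_HC_CM hF hCM⟩⟩

/-- **Eigen input ⟹ field inputs, fact-free but for `hF`**, granted S_ZD: `DA_eig ⟹ DA_q ∧ DA_K` (through `HC_CM`,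
with NO André binder). [cite: Deligne1982HodgeCycles, Prop. 6.1] -/
theorem denselyAnchoredWeil_of_denselyAnchoredEigen_of_spreadZD (hF : deligne1982_cmDenseMumfordTateFamilies)
    (hD : DenselyAnchoredEigenWeilClassesCM) (hS : SpreadFromZariskiDenseCMPoints) :
    DenselyAnchoredWeilFamiliesImaginaryQuadratic ∧ DenselyAnchoredWeilFamiliesCMField :=
  have hCM : CMAbelianHodge := HC_CM_of_denselyAnchoredEigen_of_spreadZD hD hS
  ⟨denselyAnchoredWeilFamiliesImaginaryQuadratic_of_deligne1982_of_HC_CM hF hCM,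
    denselyAnchoredWeilFamiliesCMField_of_deligne1982_of_HC_CM hF hCM⟩

/-- **Field inputs ⟹ eigen input costs André 1992**, granted S_ZD and `hF`: `DA_q ∧ DA_K ⟹ DA_eig` mod [h𝔄] (through
`HC_CM` by part II's (D_ZD)). As typed, with neither S_ZD nor the facts, DA_eig and `DA_q ∧ DA_K` are INCOMPARABLE
(different carriers and eigenvalue fields). [cite: Andre1992HodgeCM, Théorème] [cite: Deligne1982HodgeCycles, Prop. 6.1] -/
theorem denselyAnchoredEigen_of_denselyAnchoredWeil_of_spreadZD (hF : deligne1982_cmDenseMumfordTateFamilies)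
    (h𝔄 : Andre1992_hodgeClasses_cmAbelianVariety_mem_span_pullback_weilClasses)
    (hDq : DenselyAnchoredWeilFamiliesImaginaryQuadratic) (hDcm : DenselyAnchoredWeilFamiliesCMField)
    (hS : SpreadFromZariskiDenseCMPoints) : DenselyAnchoredEigenWeilClassesCM :=
  denselyAnchoredEigen_of_deligne1982_of_HC_CM hF (HC_CM_of_denselyAnchored_of_spreadZD h𝔄 hDq hDcm hS)

end Summit.HodgeConjecture.HodgeConjecture.Ring2.AbelianAll

end
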